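import Summits.BirchSwinnertonDyer.Rank1Residual.P2.PrintCf2SplitBadTwoRangeCut
import Summits.BirchSwinnertonDyer.Rank1Residual.P2.PrintCf2SplitBadTwoMassValue
import HarnessLib

set_option autoImplicit false

/-!
# The range-sliced receptacles of the cut at `p = 2` — `LMeasureFactWithOn R`, `OnWitnessesOn R`,
# `MeasureValueOn R`, `MassValueOn R`, `MeasureValueWitnessOn R` — and the `j = 0` endpoint body:
# `LMeasureFactWithOn RJ0 ι v v̄ ⊤` IS the `j = 0` existence statement (`IsLMeasure₀`-currency)

Sequel of `PrintCf2SplitBadTwoRangeCut.lean` (`IsLMeasureOn R`, `RJ0`, the identification with de Shalit's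
`j = 0` twin `IsLMeasure₀` of `Literature/…/DeShalit1987/KatzMeasureJZero.lean`).  The tree's receptacles
`LMeasureFactWith` / `MeasureValue` / `MeasureValueWitness` (`DeShalit1987/KatzObjectValue.lean`) and
`FiniteLevel.OnWitnesses` / `MassValue` (`PrintCf2SplitBadTwoMassValue.lean`) are keyed on the FULL range
(49)–(50) (de Shalit II Thm. 4.14 (36), p. 71; II.4.16, p. 76–77); here the range is the parameter `R`:

* §3 `LMeasureFactWithOn R` (`∃`-form: a smaller range is WEAKER — `lMeasureFactWithOn_of_lMeasureFactWith`,
  `LMeasureFactWithOn.anti`), `OnWitnessesOn R` / `MeasureValueOn R` / `FrameContinuousOn R` / `MassValueOn R`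
  (`∀`-over-witnesses: a smaller range is STRONGER — `onWitnesses_of_onWitnessesOn`), ★ `measureValueOn_iff_massValueOn`
  (the finite-level equivalence for every `R`: the range hypothesis is threaded, never used), `MeasureValueWitnessOn R`
  and ★ `measureValueWitnessOn_of_cut` (shape ∧ value clause ⟹ one witness, on the slice), and the exact
  mixed-key implication `measureValueOn_of_measureValue_of_upgrade`.
* §3b `JZeroEndpointBody ι v v̄` — at one `(K, ι, v, v̄)`, the INLINE `j = 0`, `3 ≤ m` existence text (the body of the
  hypothesis of `DeShalit1987.katzDistributions₂₀_of_inlineLMeasures₀_classNumberOne`; at `p = 2` the conclusion of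
  the endpoint `lMeasureJZero_classNumberOne_two` of `Summits/BirchSwinnertonDyer`), ★
  `lMeasureFactWithOn_RJ0_true_iff_endpoint` (`LMeasureFactWithOn RJ0 ι v v̄ ⊤ ⟺ JZeroEndpointBody ι v v̄`),
  `jZeroEndpointBody_iff_isLMeasure₀` (the same body in `IsLMeasure₀`-currency, `Iff.rfl`), and
  `katzDistributions₂₀_of_jZeroEndpointBody` (the endpoint bodies compose BY NAME to the `j = 0` distribution currency
  `IsKatzDistribution₂₀` through `katzDistributions₂₀_of_inlineLMeasures₀_classNumberOne`).  An extra clause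
  `Extra ≠ ⊤` (e.g. `IsCosetValues`, II.5.2 (4)) is NOT part of the endpoint body.

Every `def` is a predicate with explicit binders (nothing is asserted); every `theorem` is proved; no named
fact, no instance, no notation.

## References

* [deShalit1987] E. de Shalit, *Iwasawa theory of elliptic curves with complex multiplication* (1987):
  II Thm. 4.12 (31) (p. 66–67), II Thm. 4.14 (36) (p. 71), II.4.16 (49)–(50) (p. 76–77), II.4.17 (54) (p. 78),
  II.5.2 (4) (p. 79–80).
-/

noncomputable section

open scoped Classical
open NumberField IsDedekindDomain Field
open Literature.NumberTheory.GaloisRepresentations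
open Literature.NumberTheory.EllipticCurves
open Literature.NumberTheory.EllipticCurves.DeShalit1987
open Summit.BirchSwinnertonDyer.Rank1Residual.P2.FiniteLevel

namespace Summit.BirchSwinnertonDyer.Rank1Residual.P2.RangeCut

/-! ## §3 The range-sliced receptacles of the cut (shape ∧ value clause ⟹ one witness) -/

section Receptacles

variable {p : ℕ} [Fact p.Prime] {K : Type} [Field K] [NumberField K]

/-- **The SHAPE of Thm. 4.14 with the range cut to `R` and an extra conjunct** (verbatim `LMeasureFactWith` with
`IsLMeasureOn R`).  `∃`-form: a smaller range is a WEAKER fact — this is what a `j = 0` twin lane delivers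
(`R := RJ0`, `Extra :=` its extra clause).  A receptacle — nothing is asserted.
[cite: deShalit1987, II Thm. 4.14 (36) (p. 71), II.4.16 (49)–(50) (p. 76–77)] -/
def LMeasureFactWithOn (R : ℕ → ℕ → Prop) (ι : PadicAlgCl p ≃+* ℂ) (v vbar : HeightOneSpectrum (𝓞 K))
    (Extra : Finset (HeightOneSpectrum (𝓞 K)) → (𝒰 : SubgroupTower (absoluteGaloisGroup K)) →
      GroupDistribution 𝒰 ℂ_[p] → Prop) : Prop :=
  ∃ (Ω δ : ℂ) (Ωp : (unrIntegers p)ˣ), Ω ≠ 0 ∧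
    (δ ^ 2 = (NumberField.discr K : ℂ) ∨ δ ^ 2 = -(NumberField.discr K : ℂ)) ∧
    ∀ (S : Finset (HeightOneSpectrum (𝓞 K))), v ∉ S → vbar ∉ S →
      ∃ (𝒰 : SubgroupTower (absoluteGaloisGroup K)) (μ : GroupDistribution 𝒰 ℂ_[p]),
        (∀ n, IsOpen (𝒰.U n : Set (absoluteGaloisGroup K))) ∧
        (⋂ n, (𝒰.U n : Set (absoluteGaloisGroup K))) ⊆ rayKer K p S ∧
        μ.bound ≤ 1 ∧
        IsLMeasureOn R ι v vbar S Ω δ ((Ωp : unrIntegers p) : ℂ_[p]) 𝒰 μ ∧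
        Extra S 𝒰 μ

variable {ι : PadicAlgCl p ≃+* ℂ} {v vbar : HeightOneSpectrum (𝓞 K)} {Sθ : Finset (HeightOneSpectrum (𝓞 K))}
  {Extra : Finset (HeightOneSpectrum (𝓞 K)) → (𝒰 : SubgroupTower (absoluteGaloisGroup K)) →
    GroupDistribution 𝒰 ℂ_[p] → Prop}
  {r l : FramedGaloisRep K (PadicAlgCl p) 1}

/-- `LMeasureFactWithOn` is ANTITONE in the range: the full-range shape (e.g. from the print
`thmII414_exists_lMeasure[_cosetValues]`) gives every slice. [cite: deShalit1987, II Thm. 4.14 (36) (p. 71), II.4.16 (49)–(50) (p. 76–77)] -/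
theorem LMeasureFactWithOn.anti {R R' : ℕ → ℕ → Prop} (hRR' : ∀ m j, R m j → R' m j)
    (h : LMeasureFactWithOn R' ι v vbar Extra) : LMeasureFactWithOn R ι v vbar Extra := by
  obtain ⟨Ω, δ, Ωp, hΩ, hδ, hS⟩ := h
  refine ⟨Ω, δ, Ωp, hΩ, hδ, fun S hvS hvbarS ↦ ?_⟩
  obtain ⟨𝒰, μ, h1, h2, h3, h4, h5⟩ := hS S hvS hvbarS
  exact ⟨𝒰, μ, h1, h2, h3, h4.anti hRR', h5⟩

/-- The tree's shape (full range) gives the shape on every slice. [cite: deShalit1987, II Thm. 4.14 (36) (p. 71), II.4.16 (49)–(50) (p. 76–77)] -/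
theorem lMeasureFactWithOn_of_lMeasureFactWith (R : ℕ → ℕ → Prop) (h : LMeasureFactWith ι v vbar Extra) :
    LMeasureFactWithOn R ι v vbar Extra := by
  obtain ⟨Ω, δ, Ωp, hΩ, hδ, hS⟩ := h
  refine ⟨Ω, δ, Ωp, hΩ, hδ, fun S hvS hvbarS ↦ ?_⟩
  obtain ⟨𝒰, μ, h1, h2, h3, h4, h5⟩ := hS S hvS hvbarS
  exact ⟨𝒰, μ, h1, h2, h3, isLMeasureOn_of_isLMeasure R h4, h5⟩

/-- **«on every witness of the `R`-sliced shape at `Sθ` carrying `Extra`, `Q 𝒰 μ`»** (verbatim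
`FiniteLevel.OnWitnesses` with `IsLMeasureOn R`).  `∀`-over-witnesses: a smaller range is a STRONGER statement.
A receptacle — nothing is asserted. [cite: deShalit1987, II Thm. 4.14 (36) (p. 71), II.4.16 (49)–(50) (p. 76–77)] -/
def OnWitnessesOn (R : ℕ → ℕ → Prop) (ι : PadicAlgCl p ≃+* ℂ) (v vbar : HeightOneSpectrum (𝓞 K))
    (Sθ : Finset (HeightOneSpectrum (𝓞 K)))
    (Extra : Finset (HeightOneSpectrum (𝓞 K)) → (𝒰 : SubgroupTower (absoluteGaloisGroup K)) →
      GroupDistribution 𝒰 ℂ_[p] → Prop)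
    (Q : (𝒰 : SubgroupTower (absoluteGaloisGroup K)) → GroupDistribution 𝒰 ℂ_[p] → Prop) : Prop :=
  ∀ (Ω δ : ℂ) (Ωp : (unrIntegers p)ˣ) (𝒰 : SubgroupTower (absoluteGaloisGroup K)) (μ : GroupDistribution 𝒰 ℂ_[p]),
    (∀ n, IsOpen (𝒰.U n : Set (absoluteGaloisGroup K))) →
    (⋂ n, (𝒰.U n : Set (absoluteGaloisGroup K))) ⊆ DeShalit1987.rayKer K p Sθ → μ.bound ≤ 1 →
    IsLMeasureOn R ι v vbar Sθ Ω δ ((Ωp : unrIntegers p) : ℂ_[p]) 𝒰 μ → Extra Sθ 𝒰 μ → Q 𝒰 μ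

/-- A slice-keyed `OnWitnessesOn R` gives the tree's `OnWitnesses` (more witnesses were covered). [cite: deShalit1987, II Thm. 4.14 (36) (p. 71), II.4.16 (49)–(50) (p. 76–77)] -/
theorem onWitnesses_of_onWitnessesOn {R : ℕ → ℕ → Prop}
    {Q : (𝒰 : SubgroupTower (absoluteGaloisGroup K)) → GroupDistribution 𝒰 ℂ_[p] → Prop}
    (h : OnWitnessesOn R ι v vbar Sθ Extra Q) : OnWitnesses ι v vbar Sθ Extra Q :=
  fun Ω δ Ωp 𝒰 μ hU hN hb hL hE ↦ h Ω δ Ωp 𝒰 μ hU hN hb (isLMeasureOn_of_isLMeasure R hL) hE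

/-- `OnWitnessesOn` is MONOTONE in the range (ANTITONE as a demand: larger range, fewer witnesses). [cite: deShalit1987, II Thm. 4.14 (36) (p. 71), II.4.16 (49)–(50) (p. 76–77)] -/
theorem OnWitnessesOn.mono_range {R R' : ℕ → ℕ → Prop}
    {Q : (𝒰 : SubgroupTower (absoluteGaloisGroup K)) → GroupDistribution 𝒰 ℂ_[p] → Prop}
    (hRR' : ∀ m j, R m j → R' m j) (h : OnWitnessesOn R ι v vbar Sθ Extra Q) :
    OnWitnessesOn R' ι v vbar Sθ Extra Q :=
  fun Ω δ Ωp 𝒰 μ hU hN hb hL hE ↦ h Ω δ Ωp 𝒰 μ hU hN hb (hL.anti hRR') hE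

/-- `OnWitnessesOn` is MONOTONE in `Q`. [cite: deShalit1987, II Thm. 4.14 (36) (p. 71), II.4.16 (49)–(50) (p. 76–77)] -/
theorem OnWitnessesOn.mono {R : ℕ → ℕ → Prop}
    {Q Q' : (𝒰 : SubgroupTower (absoluteGaloisGroup K)) → GroupDistribution 𝒰 ℂ_[p] → Prop}
    (hQ : ∀ 𝒰 μ, Q 𝒰 μ → Q' 𝒰 μ) (h : OnWitnessesOn R ι v vbar Sθ Extra Q) : OnWitnessesOn R ι v vbar Sθ Extra Q' :=
  fun Ω δ Ωp 𝒰 μ hU hN hb hL hE ↦ hQ 𝒰 μ (h Ω δ Ωp 𝒰 μ hU hN hb hL hE)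

/-- **The value clause on the slice**: for every witness of the `R`-sliced shape (verbatim `MeasureValue`).
A receptacle — nothing is asserted. [cite: deShalit1987, II Thm. 4.14 (36) (p. 71), II.4.16 (49)–(50) (p. 76–77)] -/
def MeasureValueOn (R : ℕ → ℕ → Prop) (ι : PadicAlgCl p ≃+* ℂ) (v vbar : HeightOneSpectrum (𝓞 K))
    (Sθ : Finset (HeightOneSpectrum (𝓞 K)))
    (Extra : Finset (HeightOneSpectrum (𝓞 K)) → (𝒰 : SubgroupTower (absoluteGaloisGroup K)) →
      GroupDistribution 𝒰 ℂ_[p] → Prop)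
    (r l : FramedGaloisRep K (PadicAlgCl p) 1) (P : ℂ_[p] → Prop) : Prop :=
  OnWitnessesOn R ι v vbar Sθ Extra fun _ μ ↦ P (μ.integral fun σ ↦ avatarValueAt r σ * avatarValueAt l σ)

/-- The slice-keyed value clause gives the tree's `MeasureValue`. [cite: deShalit1987, II Thm. 4.14 (36) (p. 71), II.4.16 (49)–(50) (p. 76–77)] -/
theorem measureValue_of_measureValueOn {R : ℕ → ℕ → Prop} {P : ℂ_[p] → Prop}
    (h : MeasureValueOn R ι v vbar Sθ Extra r l P) : MeasureValue ι v vbar Sθ Extra r l P :=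
  fun Ω δ Ωp 𝒰 μ hU hN hb hL hE ↦ h Ω δ Ωp 𝒰 μ hU hN hb (isLMeasureOn_of_isLMeasure R hL) hE

/-- The frame integrand is tower-continuous on every witness of the slice (verbatim `FrameContinuous`).
A receptacle — nothing is asserted. [cite: deShalit1987, II Thm. 4.14 (36) (p. 71), II.4.16 (49)–(50) (p. 76–77)] -/
def FrameContinuousOn (R : ℕ → ℕ → Prop) (ι : PadicAlgCl p ≃+* ℂ) (v vbar : HeightOneSpectrum (𝓞 K))
    (Sθ : Finset (HeightOneSpectrum (𝓞 K)))
    (Extra : Finset (HeightOneSpectrum (𝓞 K)) → (𝒰 : SubgroupTower (absoluteGaloisGroup K)) →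
      GroupDistribution 𝒰 ℂ_[p] → Prop)
    (r l : FramedGaloisRep K (PadicAlgCl p) 1) : Prop :=
  OnWitnessesOn R ι v vbar Sθ Extra (fun 𝒰 _ ↦ 𝒰.IsTowerContinuous fun σ ↦ avatarValueAt r σ * avatarValueAt l σ)

/-- **MASS FORM on the slice** (verbatim `MassValue`): the finite-level statement (one Riemann sum at a level
past the oscillation threshold). A receptacle — nothing is asserted. [cite: deShalit1987, II Thm. 4.14 (36) (p. 71), II.4.16 (49)–(50) (p. 76–77)] -/
def MassValueOn (R : ℕ → ℕ → Prop) (ι : PadicAlgCl p ≃+* ℂ) (v vbar : HeightOneSpectrum (𝓞 K))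
    (Sθ : Finset (HeightOneSpectrum (𝓞 K)))
    (Extra : Finset (HeightOneSpectrum (𝓞 K)) → (𝒰 : SubgroupTower (absoluteGaloisGroup K)) →
      GroupDistribution 𝒰 ℂ_[p] → Prop)
    (r l : FramedGaloisRep K (PadicAlgCl p) 1) (ε : ℝ) : Prop :=
  OnWitnessesOn R ι v vbar Sθ Extra fun 𝒰 μ ↦ ∃ N : ℕ,
    (∀ n, N ≤ n → ∀ σ τ : absoluteGaloisGroup K, 𝒰.proj n σ = 𝒰.proj n τ →
      ‖avatarValueAt r σ * avatarValueAt l σ - avatarValueAt r τ * avatarValueAt l τ‖ ≤ ε) ∧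
    ‖μ.riemannSum (fun σ ↦ avatarValueAt r σ * avatarValueAt l σ) N‖ ≤ ε

/-- MASS FORM ⟹ value clause on the slice — the tree's proof VERBATIM: the range hypothesis `hL` is threaded and
NEVER used (the finite-level receptacle is range-free). [cite: deShalit1987, II Thm. 4.14 (36) (p. 71), II.4.16 (49)–(50) (p. 76–77)] -/
theorem measureValueOn_of_massValueOn {R : ℕ → ℕ → Prop} {ε : ℝ} (hε : 0 ≤ ε)
    (hcont : FrameContinuousOn R ι v vbar Sθ Extra r l) (h : MassValueOn R ι v vbar Sθ Extra r l ε) :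
    MeasureValueOn R ι v vbar Sθ Extra r l (fun z ↦ ‖z‖ ≤ ε) := by
  intro Ω δ Ωp 𝒰 μ hU hN hb hL hE
  obtain ⟨N, hosc, hRS⟩ := h Ω δ Ωp 𝒰 μ hU hN hb hL hE
  exact μ.norm_integral_le_of_riemannSum (hcont Ω δ Ωp 𝒰 μ hU hN hb hL hE) hb hε hosc le_rfl hRS

/-- Value clause ⟹ MASS FORM on the slice (verbatim). [cite: deShalit1987, II Thm. 4.14 (36) (p. 71), II.4.16 (49)–(50) (p. 76–77)] -/
theorem massValueOn_of_measureValueOn {R : ℕ → ℕ → Prop} {ε : ℝ} (hε : 0 < ε)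
    (hcont : FrameContinuousOn R ι v vbar Sθ Extra r l)
    (h : MeasureValueOn R ι v vbar Sθ Extra r l (fun z ↦ ‖z‖ ≤ ε)) : MassValueOn R ι v vbar Sθ Extra r l ε := by
  intro Ω δ Ωp 𝒰 μ hU hN hb hL hE
  have hf := hcont Ω δ Ωp 𝒰 μ hU hN hb hL hE
  obtain ⟨N, hosc⟩ := hf.exists_forall_norm_sub_le hε
  exact ⟨N, hosc, μ.norm_riemannSum_le_of_integral hf hb hε.le hosc (h Ω δ Ωp 𝒰 μ hU hN hb hL hE) le_rfl⟩

/-- ★ **The finite-level equivalence holds on EVERY slice** (`ε > 0`; in use `ε = 2^{−M/2}`). [cite: deShalit1987, II Thm. 4.14 (36) (p. 71), II.4.16 (49)–(50) (p. 76–77)] -/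
theorem measureValueOn_iff_massValueOn {R : ℕ → ℕ → Prop} {ε : ℝ} (hε : 0 < ε)
    (hcont : FrameContinuousOn R ι v vbar Sθ Extra r l) :
    MeasureValueOn R ι v vbar Sθ Extra r l (fun z ↦ ‖z‖ ≤ ε) ↔ MassValueOn R ι v vbar Sθ Extra r l ε :=
  ⟨massValueOn_of_measureValueOn hε hcont, measureValueOn_of_massValueOn hε.le hcont⟩

/-- **ONE WITNESS of the slice** (verbatim `MeasureValueWitness` with `IsLMeasureOn R`).  `∃`-form: WEAKER than
the tree's; it is what the `j = 0`-keyed cut produces, and what a `j = 0`-keyed Katz object is built from.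
A receptacle — nothing is asserted. [cite: deShalit1987, II Thm. 4.14 (36) (p. 71), II.4.16 (49)–(50) (p. 76–77)] -/
def MeasureValueWitnessOn (R : ℕ → ℕ → Prop) (ι : PadicAlgCl p ≃+* ℂ) (v vbar : HeightOneSpectrum (𝓞 K))
    (Sθ : Finset (HeightOneSpectrum (𝓞 K))) (r l : FramedGaloisRep K (PadicAlgCl p) 1)
    (P : ℂ_[p] → Prop) : Prop :=
  ∃ (Ω δ : ℂ) (Ωp : (unrIntegers p)ˣ) (𝒰 : SubgroupTower (absoluteGaloisGroup K)) (μ : GroupDistribution 𝒰 ℂ_[p]),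
    Ω ≠ 0 ∧ (δ ^ 2 = (NumberField.discr K : ℂ) ∨ δ ^ 2 = -(NumberField.discr K : ℂ)) ∧
    (∀ n, IsOpen (𝒰.U n : Set (absoluteGaloisGroup K))) ∧
    (⋂ n, (𝒰.U n : Set (absoluteGaloisGroup K))) ⊆ rayKer K p Sθ ∧ μ.bound ≤ 1 ∧
    IsLMeasureOn R ι v vbar Sθ Ω δ ((Ωp : unrIntegers p) : ℂ_[p]) 𝒰 μ ∧
    P (μ.integral fun σ ↦ avatarValueAt r σ * avatarValueAt l σ)

/-- The tree's witness is a witness of every slice. [cite: deShalit1987, II Thm. 4.14 (36) (p. 71), II.4.16 (49)–(50) (p. 76–77)] -/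
theorem measureValueWitnessOn_of_measureValueWitness (R : ℕ → ℕ → Prop) {P : ℂ_[p] → Prop}
    (h : MeasureValueWitness ι v vbar Sθ r l P) : MeasureValueWitnessOn R ι v vbar Sθ r l P := by
  obtain ⟨Ω, δ, Ωp, 𝒰, μ, hΩ, hδ, hU, hN, hb, hμ, hP⟩ := h
  exact ⟨Ω, δ, Ωp, 𝒰, μ, hΩ, hδ, hU, hN, hb, isLMeasureOn_of_isLMeasure R hμ, hP⟩

/-- ★ **THE SLICE-KEYED CUT GLUE** (verbatim `measureValueWitness_of_cut` on the slice): the `R`-sliced shape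
(`R := RJ0`: the `j = 0` existence statement) ∧ `v, v̄ ∉ Sθ` ∧ the `R`-sliced value clause (the value roads never
read the range) ⟹ ONE `R`-sliced witness with the value. [cite: deShalit1987, II Thm. 4.14 (36) (p. 71), II.4.16 (49)–(50) (p. 76–77)] -/
theorem measureValueWitnessOn_of_cut {R : ℕ → ℕ → Prop} {P : ℂ_[p] → Prop}
    (hfact : LMeasureFactWithOn R ι v vbar Extra) (hvS : v ∉ Sθ) (hvbarS : vbar ∉ Sθ)
    (hval : MeasureValueOn R ι v vbar Sθ Extra r l P) : MeasureValueWitnessOn R ι v vbar Sθ r l P := by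
  obtain ⟨Ω, δ, Ωp, hΩ, hδ, hS⟩ := hfact
  obtain ⟨𝒰, μ, hU, hN, hb, hμ, hE⟩ := hS Sθ hvS hvbarS
  exact ⟨Ω, δ, Ωp, 𝒰, μ, hΩ, hδ, hU, hN, hb, hμ, hval Ω δ Ωp 𝒰 μ hU hN hb hμ hE⟩

/-- **Mixed keys do NOT glue for free**: the FULL-range value clause (`MeasureValue`, keyed on fewer witnesses) and
an `R`-sliced shape give an `R`-sliced witness only through a slice-keyed value clause — recorded as the exact
implication that IS available: a slice-keyed clause from a full-keyed one PLUS a range-upgrade on witnesses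
(`hup`: every `R`-sliced witness carrying `Extra` already satisfies the full range — e.g. by J0 RIGIDITY; this is
a price paid on the measure side instead of at the key). [cite: deShalit1987, II Thm. 4.14 (36) (p. 71), II.4.16 (49)–(50) (p. 76–77)] -/
theorem measureValueOn_of_measureValue_of_upgrade {R : ℕ → ℕ → Prop} {P : ℂ_[p] → Prop}
    (hup : OnWitnessesOn R ι v vbar Sθ Extra fun 𝒰 μ ↦
      ∀ (Ω δ : ℂ) (Ωp : (unrIntegers p)ˣ), IsLMeasureOn R ι v vbar Sθ Ω δ ((Ωp : unrIntegers p) : ℂ_[p]) 𝒰 μ →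
        IsLMeasure ι v vbar Sθ Ω δ ((Ωp : unrIntegers p) : ℂ_[p]) 𝒰 μ)
    (h : MeasureValue ι v vbar Sθ Extra r l P) : MeasureValueOn R ι v vbar Sθ Extra r l P :=
  fun Ω δ Ωp 𝒰 μ hU hN hb hL hE ↦ h Ω δ Ωp 𝒰 μ hU hN hb (hup Ω δ Ωp 𝒰 μ hU hN hb hL hE Ω δ Ωp hL) hE

end Receptacles

/-! ## §3b The `j = 0` endpoint body IS the `RJ0`-slice of the shape with `Extra := ⊤` -/

section Endpoint

variable {p : ℕ} [Fact p.Prime] {K : Type} [Field K] [NumberField K]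

/-- **The `j = 0`, `3 ≤ m` existence text at one `(K, ι, v, v̄)`** — verbatim the body (after the binders on
`K, ι, v, v̄`) of the hypothesis of `DeShalit1987.katzDistributions₂₀_of_inlineLMeasures₀_classNumberOne`
(`IsLMeasure₀` inlined at `j := (0 : ℕ)`: infinity type `(fun _ ↦ ((0 : ℕ) : ℤ))`, exponent `m + 0`); at `p = 2`
the conclusion of the endpoint `lMeasureJZero_classNumberOne_two` of `Summits/BirchSwinnertonDyer`.  A receptacle —
nothing is asserted. [cite: deShalit1987, II Thm. 4.12 (31) (p. 66–67), II.4.16 (49)–(50) (p. 76–77)] -/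
def JZeroEndpointBody (ι : PadicAlgCl p ≃+* ℂ) (v vbar : HeightOneSpectrum (𝓞 K)) : Prop :=
  ∃ (Ω δ : ℂ) (Ωp : (unrIntegers p)ˣ), Ω ≠ 0 ∧
    (δ ^ 2 = (NumberField.discr K : ℂ) ∨ δ ^ 2 = -(NumberField.discr K : ℂ)) ∧
    ∀ (S : Finset (HeightOneSpectrum (𝓞 K))), v ∉ S → vbar ∉ S →
      ∃ (𝒰 : SubgroupTower (absoluteGaloisGroup K)) (μ : GroupDistribution 𝒰 ℂ_[p]),
        (∀ n, IsOpen (𝒰.U n : Set (absoluteGaloisGroup K))) ∧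
        (⋂ n, (𝒰.U n : Set (absoluteGaloisGroup K))) ⊆ DeShalit1987.rayKer K p S ∧
        μ.bound ≤ 1 ∧
        ∀ (ε : HeckeCharacter K) (e : FramedGaloisRep K (PadicAlgCl p) 1) (m : ℕ),
          IsPAdicAvatarOutside S ι ε e → 3 ≤ m →
          ε.HasInfinityType (fun _ ↦ -(m : ℤ)) (fun _ ↦ ((0 : ℕ) : ℤ)) →
          (∀ w : HeightOneSpectrum (𝓞 K), w ∉ S → w ≠ vbar → ε.IsUnramifiedAt w) →
          𝒰.IsTowerContinuous (fun σ ↦ avatarValueAt e σ) →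
          ∀ hL : LFunction.HasEntireContinuation (heckeLFunction ε),
            μ.integral (fun σ ↦ avatarValueAt e σ) =
              ((ι.symm (DeShalit1987.interpolationValue p v vbar S ε m 0 Ω δ (hL.continuation 0)) :
                  PadicAlgCl p) : ℂ_[p]) * ((Ωp : unrIntegers p) : ℂ_[p]) ^ (m + 0)

variable {ι : PadicAlgCl p ≃+* ℂ} {v vbar : HeightOneSpectrum (𝓞 K)}

/-- The endpoint body in `IsLMeasure₀`-currency — on the nose (`DeShalit1987.isLMeasure₀_iff` is `Iff.rfl`).
[cite: deShalit1987, II Thm. 4.12 (31) (p. 66–67), II.4.16 (49)–(50) (p. 76–77)] -/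
theorem jZeroEndpointBody_iff_isLMeasure₀ :
    JZeroEndpointBody ι v vbar ↔
      ∃ (Ω δ : ℂ) (Ωp : (unrIntegers p)ˣ), Ω ≠ 0 ∧
        (δ ^ 2 = (NumberField.discr K : ℂ) ∨ δ ^ 2 = -(NumberField.discr K : ℂ)) ∧
        ∀ (S : Finset (HeightOneSpectrum (𝓞 K))), v ∉ S → vbar ∉ S →
          ∃ (𝒰 : SubgroupTower (absoluteGaloisGroup K)) (μ : GroupDistribution 𝒰 ℂ_[p]),
            (∀ n, IsOpen (𝒰.U n : Set (absoluteGaloisGroup K))) ∧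
            (⋂ n, (𝒰.U n : Set (absoluteGaloisGroup K))) ⊆ DeShalit1987.rayKer K p S ∧
            μ.bound ≤ 1 ∧
            IsLMeasure₀ ι v vbar S Ω δ ((Ωp : unrIntegers p) : ℂ_[p]) 𝒰 μ :=
  Iff.rfl

/-- ★ **The `j = 0` endpoint body IS the `RJ0`-slice of the shape with `Extra := ⊤`** (through
`isLMeasureOn_RJ0_iff_isLMeasure₀`).  For an extra clause `Extra ≠ ⊤` (e.g. the coset values II.5.2 (4)) the slice
`LMeasureFactWithOn RJ0 ι v v̄ Extra` asks more than the endpoint body states.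
[cite: deShalit1987, II Thm. 4.12 (31) (p. 66–67), II Thm. 4.14 (36) (p. 71), II.4.16 (49)–(50) (p. 76–77)] -/
theorem lMeasureFactWithOn_RJ0_true_iff_endpoint :
    LMeasureFactWithOn RJ0 ι v vbar (fun _ _ _ ↦ True) ↔ JZeroEndpointBody ι v vbar := by
  rw [jZeroEndpointBody_iff_isLMeasure₀]
  constructor
  · rintro ⟨Ω, δ, Ωp, hΩ, hδ, hS⟩
    refine ⟨Ω, δ, Ωp, hΩ, hδ, fun S hvS hvbarS ↦ ?_⟩
    obtain ⟨𝒰, μ, h1, h2, h3, h4, -⟩ := hS S hvS hvbarS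
    exact ⟨𝒰, μ, h1, h2, h3, isLMeasureOn_RJ0_iff_isLMeasure₀.mp h4⟩
  · rintro ⟨Ω, δ, Ωp, hΩ, hδ, hS⟩
    refine ⟨Ω, δ, Ωp, hΩ, hδ, fun S hvS hvbarS ↦ ?_⟩
    obtain ⟨𝒰, μ, h1, h2, h3, h4⟩ := hS S hvS hvbarS
    exact ⟨𝒰, μ, h1, h2, h3, isLMeasureOn_RJ0_iff_isLMeasure₀.mpr h4, trivial⟩

/-- An `RJ0`-slice of the shape with ANY extra clause gives the endpoint body (forget `Extra`).
[cite: deShalit1987, II Thm. 4.12 (31) (p. 66–67), II.4.16 (49)–(50) (p. 76–77)] -/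
theorem jZeroEndpointBody_of_lMeasureFactWithOn_RJ0
    {Extra : Finset (HeightOneSpectrum (𝓞 K)) → (𝒰 : SubgroupTower (absoluteGaloisGroup K)) →
      GroupDistribution 𝒰 ℂ_[p] → Prop}
    (h : LMeasureFactWithOn RJ0 ι v vbar Extra) : JZeroEndpointBody ι v vbar := by
  refine lMeasureFactWithOn_RJ0_true_iff_endpoint.mp ?_
  obtain ⟨Ω, δ, Ωp, hΩ, hδ, hS⟩ := h
  refine ⟨Ω, δ, Ωp, hΩ, hδ, fun S hvS hvbarS ↦ ?_⟩
  obtain ⟨𝒰, μ, h1, h2, h3, h4, -⟩ := hS S hvS hvbarS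
  exact ⟨𝒰, μ, h1, h2, h3, h4, trivial⟩

/-- **The endpoint bodies compose BY NAME to the `j = 0` distribution currency**: at a fixed prime, the endpoint
body at every imaginary quadratic `K` of class number one and every split pair `(v, v̄)` gives, for every
algebraic `λ` unramified outside `S ∪ {v, v̄}` and every independent pair `(κ₁, κ₂)`, a bounded distribution on
`ℤ_p²` of norm `≤ 1` with `IsKatzDistribution₂₀` — `DeShalit1987.katzDistributions₂₀_of_inlineLMeasures₀_classNumberOne`
verbatim (the hypothesis texts agree definitionally).
[cite: deShalit1987, II Thm. 4.12 (31) (p. 66–67), II.4.16 (49)–(50) (p. 76–77), II.4.17 (54) (p. 77–78)] -/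
theorem katzDistributions₂₀_of_jZeroEndpointBody (p : ℕ) [Fact p.Prime]
    (hν : ∀ (K : Type) [Field K] [NumberField K], IsImaginaryQuadratic K → NumberField.classNumber K = 1 →
      ∀ (ι : PadicAlgCl p ≃+* ℂ) (v vbar : HeightOneSpectrum (𝓞 K)),
        ((p : ℕ) : 𝓞 K) ∈ v.asIdeal → ((p : ℕ) : 𝓞 K) ∈ vbar.asIdeal → vbar ≠ v →
        (∀ (w : InfinitePlace K) (k : 𝓞 K), k ∈ v.asIdeal ↔ ‖ι.symm (w.embedding (k : K))‖ < 1) →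
        JZeroEndpointBody ι v vbar) :
    ∀ (K : Type) [Field K] [NumberField K], IsImaginaryQuadratic K → NumberField.classNumber K = 1 →
      ∀ (ι : PadicAlgCl p ≃+* ℂ) (v vbar : HeightOneSpectrum (𝓞 K)),
        ((p : ℕ) : 𝓞 K) ∈ v.asIdeal → ((p : ℕ) : 𝓞 K) ∈ vbar.asIdeal → vbar ≠ v →
        (∀ (w : InfinitePlace K) (k : 𝓞 K), k ∈ v.asIdeal ↔ ‖ι.symm (w.embedding (k : K))‖ < 1) →
      ∃ (Ω δ : ℂ) (Ωp : (unrIntegers p)ˣ), Ω ≠ 0 ∧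
        (δ ^ 2 = (NumberField.discr K : ℂ) ∨ δ ^ 2 = -(NumberField.discr K : ℂ)) ∧
        ∀ (S : Finset (HeightOneSpectrum (𝓞 K))), v ∉ S → vbar ∉ S →
        ∀ (lam : HeckeCharacter K), lam.IsAlgebraic →
          (∀ w : HeightOneSpectrum (𝓞 K), w ∉ S → w ≠ v → w ≠ vbar → lam.IsUnramifiedAt w) →
        ∀ (κ₁ κ₂ : ZpExtension K p), κ₁.IsIndependent κ₂ →
          ∃ D : BoundedDistribution (padicIntSq p) ℂ_[p], D.bound ≤ 1 ∧
            IsKatzDistribution₂₀ ι v vbar S κ₁ κ₂ lam Ω δ ((Ωp : unrIntegers p) : ℂ_[p]) D :=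
  katzDistributions₂₀_of_inlineLMeasures₀_classNumberOne p
    fun K _ _ hK hh ι v vbar hv hvbar hne hι ↦ hν K hK hh ι v vbar hv hvbar hne hι

end Endpoint

end Summit.BirchSwinnertonDyer.Rank1Residual.P2.RangeCut

end
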